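import Summits.QuantumFields.BalabanUV.Beta.GAN24.DirichletBoxTwoLevelCore

/-!
# `BalabanUV.Beta.GAN24.DirichletBoxTwoLevel` — binder row G-an2-4 / (CONV-C), road P2 PART II, module M-E (file 2): THE END —
# THE TWO-LEVEL INJECTED LAW OF THE Ω-COMPRESSED `U = 1` SCALAR FREE TOWER ON A BOX OF UNIT BLOCKS, rate `L^{−k}`, Plancherel-free
# (unit b2b-balaban-gan24-p2, gen 22, v1)

HONEST FRAMING (cell contract, verbatim): «discharging `BetaPertH` makes Bałaban's UV stability UNCONDITIONAL — a real constructive-QFT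
result; it is NOT the continuum limit and NOT the Clay problem.»  SUPPLIER item «Δ1-BOX-SCALAR» under the T⁴-DAG sub-row
`T4-U1a.S-NE2-D1-DIRICHLET°` (holder: the t4-ne2-p1 lineage; OWNER RULING R20 (c), journal l.13903: «the TARGET SHAPE that plugs into the
owner's END is literally the binder `hinj : ∀ k, ‖(D^Ω_{k+1})⁻¹·J^Ω_k − J^Ω_k·(D^Ω_k)⁻¹‖ ≤ e₁ k` for your scalar carriers»).  The objects:
the `U = 1` SCALAR layer `Δ′ = DeltaPs n M a′ = LapS + a′•PiS` ([Balaban1985BackgroundPropagators] (3.24) p. 394 «Δ′_a = Δ^η_U + Q′*aQ′» at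
`U = 1`), COMPRESSED to a region exactly as printed there («the operator Δ′_a with Dirichlet boundary conditions on ∂Ω₀, i.e. the operator
Δ′_a↾Ω₀ = Ω₀Δ′_aΩ₀»): `D^Ω = (Δ′)_{ΩΩ}` on `ℓ²(Ω)` — zero OUTSIDE `Ω`, boundary = first exterior layer, NO reflection, NO modified
stencil (module M-C `DirichletBoxCompression.DOm`); King's 0-form planting `J₀ = ScalarBlockPlanting.JK0 N R M` compressed to `J^Ω = (J₀)_{Ω′Ω}`
(`JOm`), `Ω′ = par⁻¹Ω`.  THE REGION: `Ω = blockReg N S`, the union of the unit blocks (of `N^d` coarse sites, `(RN)^d` fine sites)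
indexed by a COORDINATE BOX `S = Π_μ S₀(μ)` of the unit torus (any product of coordinate sets: boxes, slabs, wrapping or not).

 * §1 **`pairing_dir_le`** (per direction, from module M-E file 1): for `u ⊂ Ω`, `v ⊂ Ω′`,
   `|⟨(A_μ − F_μ)v, ∂_μu⟩| ≤ ((2 + 8√(2R))/N)·√(‖∂_μu‖² + H_μ(u))·√(‖∂′_μv‖² + H′_μ(v))`, and summed over `μ` (**`pairing_le`**):
   `|⟨v, (J₀Δ_N − Δ_{RN}J₀)u⟩| ≤ ((2 + 8√(2R))/N)·√(Σ_μ‖∂_μu‖² + H_Ω(u))·√(Σ_μ‖∂′_μv‖² + H_{Ω′}(v))`.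
 * §2 block regions over coordinate boxes are CORNER-FREE coordinate-product sets (module M-R `cornerFree_prodSet`), so the INTERIOR
   diagonal Hessian of a zero-extended Dirichlet solution is bounded by its compressed Laplacian (`hdiag_le_sum_normSq_LapS`), hence by
   `2(1 + (a′γ′⁻¹)²)·‖f‖²` (module M-C); with the energy bound `γ′⁻¹‖f‖²` this gives the budget `Λ = γ′⁻¹ + 2(1 + (a′γ′⁻¹)²)` per level.
 * §3 **THE END `injected_le_box`**: for `d`-arbitrary, `a′ > 0`, `N, R ≥ 1`:
   `‖(D′^{Ω′})⁻¹·J^Ω − J^Ω·(D^Ω)⁻¹‖ ≤ (2 + 8√(2R))·(γ′⁻¹ + 2(1 + (a′γ′⁻¹)²)) / N`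
   — along the tower `N = L^k`, `R = L`: the holder's `hinj` for the scalar carriers on box regions with `e₁ k = Cbox(d,a′,L)·L^{−k}`,
   `Cbox = (2 + 8√(2L))(γ′⁻¹ + 2(1 + (a′γ′⁻¹)²))`, `γ′ = gammaPs d a′` — THE SAME RATE `L^{−k}` AS THE TORUS, every `d ≥ 1`.
   The `√L` in the constant comes only from the crude (unaligned) treatment of the boundary windows in file 1 §4 and is removable by a
   face-by-face Cauchy–Schwarz (memo §1 L3/L4); for the tower (`L` fixed) it is immaterial.

LOCATED (prose): for a GENERAL union of unit blocks only the corner-free `H²` step (module M-R) fails — at re-entrant edges; every other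
module of road P2 PART II (M-W, M-P, M-C, M-T, this file's §1) is stated and proved for arbitrary unions of unit blocks.  The general-region
law therefore holds CONDITIONALLY on one displayed inequality `Σ_μ Σ_{x∈Ω}|(∂_μᴴ∂_μz)(x)|² ≤ κ²·Σ_{x∈Ω}|(Δz)(x)|²` (both levels) — the
holder's «discrete elliptic regularity up to ∂Ω» reduced to one line; consistent with leaf-07-g4's census (rate `L^{−γ}`, `γ < 1`, expected at
Fichera-type vertices in `d ≥ 3`).

ABSOLUTE RULE (cell, verbatim): «No internally-minted statement may enter as a cited fact. Every hypothesis is either kernel-proved in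
this package or a verbatim quotation of a PUBLISHED theorem with page reference. The manuscript(s) under audit are NOT citable for
their own disputed steps — they are the thing under adjudication; programme-internal (2001/route/tribunal) claims are never citable.»
[folklore] finite lattice calculus on the tree's typed `U = 1` objects; nothing printed is a hypothesis.  NOT CLAIMED: the vector layer
(`calDalev` with the non-local `−∂P∂*` term — the holder's carriers), multi-region `{Ω_j}` / recursive `a_j`, NE2, the torus rates of
`G_k`/`H_k` as printed objects, (CONV-C) as a whole, `BetaPertH`, continuum, Clay.  «not in print; our proof attempt» — [B9] prints only the
η-UNIFORM bounds (3.42) for these operators.  HONEST DEPENDENCY: continuum YM on T⁴ ⇐ BetaPertH ∧ nine spine estimates (0/9 proved);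
BetaPertH ⇐ (D1) ∧ (D4) ∧ CAP+tail; G-an2-4 gates asym, D1 and NE2/3/4.
-/

noncomputable section

open scoped BigOperators ComplexConjugate Matrix Matrix.Norms.L2Operator
open Finset Polynomial

namespace Summit.QuantumFields.BalabanUV.Beta.GAN24.DirichletBoxTwoLevel

open Literature.MathematicalPhysics.QuantumFieldTheory.Balaban1983to89.B5Prop11Plancherel (Tor fine unitVec)
open Literature.MathematicalPhysics.QuantumFieldTheory.Balaban1983to89.B5Action121 (shiftS sdiff LapS shiftS_mulVec sdiff_mulVec
  star_mulVec_dotProduct dotProduct_mulVec_eq_star_conjTranspose_mulVec)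
open Literature.MathematicalPhysics.QuantumFieldTheory.Balaban1983to89.B5Prop11Lower (nsq nsq_nonneg star_dotProduct_self
  norm_star_dotProduct_le)
open Literature.MathematicalPhysics.QuantumFieldTheory.Balaban1983to89.B5Blocks16 (blockOf)
open Summit.QuantumFields.BalabanUV.T4Continuum
open Summit.QuantumFields.BalabanUV.T4Continuum.BalabanAveragedTowerModes (par)
open Summit.QuantumFields.BalabanUV.T4Continuum.ScalarBlockPlanting (Qavg0 JK0)
open Summit.QuantumFields.BalabanUV.T4Continuum.ScalarAveragedPropagator (DeltaPs gammaPs dirichlet gammaPs_pos dirichlet_nonneg)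
open Summit.QuantumFields.BalabanUV.T4Continuum.ScalarPlantingDefect (val_blockOf)
open Summit.QuantumFields.BalabanUV.Beta.GAN24.DirichletBoxRegularity (Pdir Pdir_mulVec SuppIn CornerFree Hdiag prodSet mem_prodSet
  cornerFree_prodSet hdiag_le_sum_normSq_LapS)
open Summit.QuantumFields.BalabanUV.Beta.GAN24.DirichletBoxPairing
open Summit.QuantumFields.BalabanUV.Beta.GAN24.DirichletBoxCompression (DOm JOm solExt refineR solExt_apply_of_not nsq_sdiff_solExt_le
  dirichlet_solExt_le sum_normSq_LapS_solExt_le form_defect opNorm_le_of_pairing)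
open Summit.QuantumFields.BalabanUV.Beta.GAN24.DirichletBoxTrace (blockReg)
open Summit.QuantumFields.BalabanUV.Beta.GAN24.DirichletBoxTwoLevelCore

variable {d : ℕ} (N R : ℕ) [NeZero N] [NeZero R] (M : Fin d → ℕ) [hM : ∀ μ, NeZero (M μ)] (S : Tor M → Prop) [DecidablePred S]

/-! ## §1 The per-direction estimate and its sum over directions -/

/-- the per-level, per-direction budget `‖∂_μz‖² + Σ_{x∈Ω} |(∂_μᴴ∂_μ z)(x)|²`. [folklore] -/
def budget (n : ℕ) [NeZero n] (μ : Fin d) (z : Tor (fine n M) → ℂ) : ℝ :=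
  nsq (sdiff (fine n M) (n : ℂ) μ *ᵥ z) + ∑ x ∈ univ.filter (blockReg n M S), ‖(Pdir (fine n M) (n : ℂ) μ *ᵥ z) x‖ ^ 2

omit [NeZero N] [NeZero R] in
/-- the budget is nonnegative. [folklore] -/
theorem budget_nonneg (n : ℕ) [NeZero n] (μ : Fin d) (z : Tor (fine n M) → ℂ) : 0 ≤ budget M S n μ z :=
  add_nonneg (nsq_nonneg _) (Finset.sum_nonneg fun _ _ => sq_nonneg _)

/-- the constant `2 + 8√(2R)` of the per-direction estimate. [folklore] -/
def cDir (R : ℕ) : ℝ := 2 + 8 * Real.sqrt (2 * (R : ℝ))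

omit [NeZero R] in
/-- `0 ≤ cDir`. [folklore] -/
theorem cDir_nonneg : 0 ≤ cDir R := by unfold cDir; positivity

/-- **THE PER-DIRECTION ESTIMATE**: for `u` vanishing off `Ω = blockReg N S` and `v` vanishing off `Ω′`,
`|⟨(A_μ − F_μ)v, ∂_μu⟩| ≤ ((2 + 8√(2R))/N)·√budget_μ(u)·√budget′_μ(v)`. [folklore] -/
theorem pairing_dir_le (μ : Fin d) {u : Tor (fine N M) → ℂ} (hu : ∀ y, ¬ blockReg N M S y → u y = 0)
    {v : Tor (fine (R * N) M) → ℂ} (hv : ∀ x, ¬ blockReg (R * N) M S x → v x = 0) :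
    ‖star ((Aop N R M μ - Fop N R M μ) *ᵥ v) ⬝ᵥ (sdiff (fine N M) (N : ℂ) μ *ᵥ u)‖
      ≤ cDir R / N * (Real.sqrt (budget M S N μ u) * Real.sqrt (budget M S (R * N) μ v)) := by
  have hNpos : (0 : ℝ) < N := by exact_mod_cast Nat.pos_of_ne_zero (NeZero.ne N)
  have hRNpos : (0 : ℝ) < ((R * N : ℕ) : ℝ) := by exact_mod_cast Nat.pos_of_ne_zero (NeZero.ne (R * N))
  set Ω := blockReg N M S with hΩ
  set P' := Pdir (fine (R * N) M) ((R * N : ℕ) : ℂ) μ with hP'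
  set a := (Aop N R M μ - Fop N R M μ) *ᵥ v with ha
  set b := sdiff (fine N M) (N : ℂ) μ *ᵥ u with hb
  -- the region `Ω′` in the two spellings
  have hΩ' : ∀ x, refineR N R M Ω x ↔ blockReg (R * N) M S x := refineR_blockReg_iff N R M S
  set gI : Tor (fine (R * N) M) → ℂ := fun x => if refineR N R M Ω x then (P' *ᵥ v) x else 0 with hgI
  set gE : Tor (fine (R * N) M) → ℂ := fun x => if refineR N R M Ω x then 0 else (P' *ᵥ v) x with hgE
  have hgE' : gE = fun x => if blockReg (R * N) M S x then 0 else (P' *ᵥ v) x := by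
    funext x; simp only [hgE, hΩ' x]
  -- `|⟨a,b⟩| ≤ Σ ‖a‖‖b‖ ≤ Σ ‖aI‖‖b‖ + Σ ‖aE‖‖bdry b‖`
  have h1 : ‖star a ⬝ᵥ b‖ ≤ ∑ y, ‖a y‖ * ‖b y‖ := by
    refine (norm_sum_le _ _).trans (Finset.sum_le_sum fun y _ => ?_)
    rw [Pi.star_apply, norm_mul, norm_star]
  have h2 : ∑ y, ‖a y‖ * ‖b y‖ ≤ ∑ y, ‖cWin d N R * winSum N R M μ gI y‖ * ‖b y‖
      + ∑ y, ‖cWin d N R * winSum N R M μ gE y‖ * ‖bdryPart N M Ω μ b y‖ := by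
    rw [← Finset.sum_add_distrib]
    refine Finset.sum_le_sum fun y _ => ?_
    rw [← exterior_pairs_bdry N R M Ω μ v hu y, ← add_mul]
    refine mul_le_mul_of_nonneg_right ?_ (norm_nonneg _)
    rw [ha, Aop_sub_Fop_mulVec_split N R M Ω μ v y]
    exact norm_add_le _ _
  -- interior part
  have hI : ∑ y, ‖cWin d N R * winSum N R M μ gI y‖ * ‖b y‖
      ≤ 2 / (N : ℝ) * (Real.sqrt (budget M S (R * N) μ v) * Real.sqrt (budget M S N μ u)) := by
    refine (interior_le N R M Ω μ v b).trans (mul_le_mul_of_nonneg_left ?_ (by positivity))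
    refine mul_le_mul (Real.sqrt_le_sqrt ?_) (Real.sqrt_le_sqrt ?_) (Real.sqrt_nonneg _) (Real.sqrt_nonneg _)
    · rw [budget, Finset.filter_congr (fun x _ => hΩ' x)]
      exact le_add_of_nonneg_left (nsq_nonneg _)
    · rw [budget]
      exact le_add_of_nonneg_right (Finset.sum_nonneg fun _ _ => sq_nonneg _)
  -- exterior part
  have hE : ∑ y, ‖cWin d N R * winSum N R M μ gE y‖ * ‖bdryPart N M Ω μ b y‖
      ≤ 2 / (N : ℝ) * (Real.sqrt (8 * ((R * N : ℕ) : ℝ) * budget M S (R * N) μ v) * Real.sqrt (4 / (N : ℝ) * budget M S N μ u)) := by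
    refine (window_cs N R M μ gE _).trans (mul_le_mul_of_nonneg_left ?_ (by positivity))
    refine mul_le_mul (Real.sqrt_le_sqrt ?_) (Real.sqrt_le_sqrt ?_) (Real.sqrt_nonneg _) (Real.sqrt_nonneg _)
    · rw [hgE', budget]; exact nsq_exterior_density_le N R M S μ hv
    · rw [budget, hb]; exact nsq_bdryPart_le N M S μ hu
  -- constants: `√(8RN·X′)·√((4/N)·X) = √(32R)·√X′·√X` and `√32 ≤ ... = 4√2`
  set X : ℝ := budget M S N μ u with hXdef
  set X' : ℝ := budget M S (R * N) μ v with hX'def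
  have hX : 0 ≤ X := budget_nonneg M S N μ u
  have hX' : 0 ≤ X' := budget_nonneg M S (R * N) μ v
  have e8 : Real.sqrt (8 * ((R * N : ℕ) : ℝ)) * Real.sqrt (4 / (N : ℝ)) = (4 : ℝ) * Real.sqrt (2 * (R : ℝ)) := by
    rw [← Real.sqrt_mul (by positivity)]
    have e2 : 8 * ((R * N : ℕ) : ℝ) * (4 / (N : ℝ)) = (4 : ℝ) ^ 2 * (2 * (R : ℝ)) := by push_cast; field_simp; ring
    rw [e2, Real.sqrt_mul (by positivity), Real.sqrt_sq (by norm_num)]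
  have hconst : Real.sqrt (8 * ((R * N : ℕ) : ℝ) * X') * Real.sqrt (4 / (N : ℝ) * X)
      = (4 : ℝ) * Real.sqrt (2 * (R : ℝ)) * (Real.sqrt X * Real.sqrt X') := by
    rw [Real.sqrt_mul (by positivity) X', Real.sqrt_mul (by positivity) X, ← e8]
    ring
  rw [hconst] at hE
  calc ‖star a ⬝ᵥ b‖ ≤ _ := h1
    _ ≤ _ := h2
    _ ≤ 2 / (N : ℝ) * (Real.sqrt X' * Real.sqrt X) + 2 / (N : ℝ) * ((4 : ℝ) * Real.sqrt (2 * (R : ℝ)) * (Real.sqrt X * Real.sqrt X')) :=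
        add_le_add hI hE
    _ = cDir R / N * (Real.sqrt X * Real.sqrt X') := by rw [cDir]; ring

/-- **THE SUMMED PAIRING ESTIMATE**: for `u ⊂ Ω`, `v ⊂ Ω′`,
`|⟨v, (J₀Δ_N − Δ_{RN}J₀)u⟩| ≤ ((2 + 8√(2R))/N)·√(Σ_μ budget_μ(u))·√(Σ_μ budget′_μ(v))`. [folklore] -/
theorem pairing_le (hN : 1 ≤ N) {u : Tor (fine N M) → ℂ} (hu : ∀ y, ¬ blockReg N M S y → u y = 0)
    {v : Tor (fine (R * N) M) → ℂ} (hv : ∀ x, ¬ blockReg (R * N) M S x → v x = 0) :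
    ‖star v ⬝ᵥ ((JK0 N R M * LapS (fine N M) (N : ℂ) - LapS (fine (R * N) M) ((R * N : ℕ) : ℂ) * JK0 N R M) *ᵥ u)‖
      ≤ cDir R / N * (Real.sqrt (∑ μ, budget M S N μ u) * Real.sqrt (∑ μ, budget M S (R * N) μ v)) := by
  have hNpos : (0 : ℝ) < N := by exact_mod_cast Nat.pos_of_ne_zero (NeZero.ne N)
  rw [pairing_identity N R M hN, Matrix.sum_mulVec, dotProduct_sum]
  refine (norm_sum_le _ _).trans ?_
  have hpair : ∀ μ, star v ⬝ᵥ (((Aop N R M μ - Fop N R M μ)ᴴ * sdiff (fine N M) (N : ℂ) μ) *ᵥ u)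
      = star ((Aop N R M μ - Fop N R M μ) *ᵥ v) ⬝ᵥ (sdiff (fine N M) (N : ℂ) μ *ᵥ u) := by
    intro μ
    rw [← Matrix.mulVec_mulVec, dotProduct_mulVec_eq_star_conjTranspose_mulVec, Matrix.conjTranspose_conjTranspose]
  calc ∑ μ, ‖star v ⬝ᵥ (((Aop N R M μ - Fop N R M μ)ᴴ * sdiff (fine N M) (N : ℂ) μ) *ᵥ u)‖
      ≤ ∑ μ, cDir R / N * (Real.sqrt (budget M S N μ u) * Real.sqrt (budget M S (R * N) μ v)) :=
        Finset.sum_le_sum fun μ _ => by rw [hpair μ]; exact pairing_dir_le N R M S μ hu hv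
    _ = cDir R / N * ∑ μ, Real.sqrt (budget M S N μ u) * Real.sqrt (budget M S (R * N) μ v) := by rw [Finset.mul_sum]
    _ ≤ cDir R / N * (Real.sqrt (∑ μ, budget M S N μ u) * Real.sqrt (∑ μ, budget M S (R * N) μ v)) :=
        mul_le_mul_of_nonneg_left (Real.sum_sqrt_mul_sqrt_le _ (fun μ => budget_nonneg M S N μ u)
          (fun μ => budget_nonneg M S (R * N) μ v)) (div_nonneg (cDir_nonneg R) hNpos.le)

/-! ## §2 Block regions over coordinate boxes are corner-free; the budget of a Dirichlet solution -/

/-- [shape] `S` is a COORDINATE BOX of unit blocks: membership is decided coordinatewise. [folklore] -/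
def IsCoordBox (S : Tor M → Prop) : Prop := ∃ S₀ : (μ : Fin d) → Finset (ZMod (M μ)), ∀ b, S b ↔ ∀ μ, b μ ∈ S₀ μ

omit [DecidablePred S] in
/-- **the block region of a coordinate box is a coordinate-product set of the torus, hence CORNER-FREE** (module M-R). [folklore] -/
theorem cornerFree_blockReg (hS : IsCoordBox M S) (n : ℕ) [NeZero n] [DecidablePred S] :
    CornerFree (fine n M) (univ.filter (blockReg n M S)) := by
  obtain ⟨S₀, hS₀⟩ := hS
  classical
  set S₁ : (μ : Fin d) → Finset (ZMod (fine n M μ)) :=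
    fun μ => univ.filter (fun a : ZMod (fine n M μ) => (((a.val / n : ℕ) : ZMod (M μ))) ∈ S₀ μ) with hS₁
  have hblock : ∀ (x : Tor (fine n M)) (μ : Fin d), blockOf n M x μ = (((x μ).val / n : ℕ) : ZMod (M μ)) := by
    intro x μ
    rw [← val_blockOf n (M := M) x μ, ZMod.natCast_zmod_val]
  have heq : univ.filter (blockReg n M S) = prodSet (fine n M) S₁ := by
    ext x
    rw [Finset.mem_filter, mem_prodSet]
    simp only [Finset.mem_univ, true_and]
    show S (blockOf n M x) ↔ _
    rw [hS₀]
    refine forall_congr' fun μ => ?_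
    rw [hS₁, Finset.mem_filter, hblock]
    simp
  rw [heq]
  exact cornerFree_prodSet (fine n M) S₁

/-- the per-level budget constant `Λ = γ′⁻¹ + 2(1 + (a′γ′⁻¹)²)`. [folklore] -/
def Lam (d : ℕ) (a' : ℝ) : ℝ := (gammaPs d a')⁻¹ + 2 * (1 + (a' * (gammaPs d a')⁻¹) ^ 2)

/-- `0 ≤ Λ`. [folklore] -/
theorem Lam_nonneg (a' : ℝ) : 0 ≤ Lam d a' := by
  have := (gammaPs_pos (d := d) (a' := a')).1
  unfold Lam; positivity

/-- **THE BUDGET OF A ZERO-EXTENDED DIRICHLET SOLUTION on a corner-free block region**: for any decidable spelling `p` of the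
region `blockReg n S`, `Σ_μ budget_μ(solExt_p f) ≤ Λ·‖f‖²` (energy bound + discrete `H²` on corner-free regions + second-difference
budget). [folklore] -/
theorem sum_budget_solExt_le (hS : IsCoordBox M S) (n : ℕ) [NeZero n] {a' : ℝ} (ha' : 0 < a') (p : Tor (fine n M) → Prop)
    [DecidablePred p] (hp : ∀ x, p x ↔ blockReg n M S x) (f : {x // p x} → ℂ) :
    ∑ μ, budget M S n μ (solExt n M a' p f) ≤ Lam d a' * nsq f := by
  set u := solExt n M a' p f with hu
  have hsupp : SuppIn (fine n M) (univ.filter (blockReg n M S)) u := by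
    intro x hx
    rw [Finset.mem_filter] at hx
    exact solExt_apply_of_not n M a' p f (fun h => hx ⟨Finset.mem_univ _, (hp x).mp h⟩)
  have hD : ∑ μ, nsq (sdiff (fine n M) (n : ℂ) μ *ᵥ u) ≤ (gammaPs d a')⁻¹ * nsq f := dirichlet_solExt_le n M a' _ ha' f
  have hH : ∑ μ, ∑ x ∈ univ.filter (blockReg n M S), ‖(Pdir (fine n M) (n : ℂ) μ *ᵥ u) x‖ ^ 2
      ≤ 2 * (1 + (a' * (gammaPs d a')⁻¹) ^ 2) * nsq f := by
    have h1 : Hdiag (n : ℂ) (univ.filter (blockReg n M S)) u ≤ ∑ x ∈ univ.filter (blockReg n M S), ‖(LapS (fine n M) (n : ℂ) *ᵥ u) x‖ ^ 2 :=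
      hdiag_le_sum_normSq_LapS (cornerFree_blockReg M S hS n) hsupp (n : ℂ)
    have h2 : ∑ x ∈ univ.filter (blockReg n M S), ‖(LapS (fine n M) (n : ℂ) *ᵥ u) x‖ ^ 2
        = ∑ a : {x // p x}, ‖(LapS (fine n M) (n : ℂ) *ᵥ u) a‖ ^ 2 :=
      Finset.sum_subtype _ (fun x => by simp [hp x]) (fun x => ‖(LapS (fine n M) (n : ℂ) *ᵥ u) x‖ ^ 2)
    have h3 := sum_normSq_LapS_solExt_le n M a' p ha' f
    rw [← hu] at h3
    exact (h1.trans (le_of_eq h2)).trans h3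
  calc ∑ μ, budget M S n μ u = ∑ μ, nsq (sdiff (fine n M) (n : ℂ) μ *ᵥ u)
        + ∑ μ, ∑ x ∈ univ.filter (blockReg n M S), ‖(Pdir (fine n M) (n : ℂ) μ *ᵥ u) x‖ ^ 2 := by
        rw [← Finset.sum_add_distrib]; rfl
    _ ≤ (gammaPs d a')⁻¹ * nsq f + 2 * (1 + (a' * (gammaPs d a')⁻¹) ^ 2) * nsq f := add_le_add hD hH
    _ = Lam d a' * nsq f := by rw [Lam]; ring

/-! ## §3 THE END -/

/-- the box constant `Cbox = (2 + 8√(2R))·Λ`. [folklore] -/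
def Cbox (d R : ℕ) (a' : ℝ) : ℝ := cDir R * Lam d a'

/-- **THE TWO-LEVEL INJECTED LAW OF THE Ω-COMPRESSED `U = 1` SCALAR FREE TOWER ON A BOX OF UNIT BLOCKS** (the holder's `hinj` shape for
the scalar carriers, one step `N ↦ RN` of the tower; along the tower `N = L^k`, `R = L` this is `e₁ k = Cbox·L^{−k}`):
for every coordinate box `S` of unit blocks, `Ω = blockReg N S`, `Ω′ = par⁻¹Ω`, every `d`, `a′ > 0`,
`‖(D′^{Ω′})⁻¹·J^Ω − J^Ω·(D^Ω)⁻¹‖ ≤ (2 + 8√(2R))·(γ′⁻¹ + 2(1 + (a′γ′⁻¹)²)) / N`.  Plancherel-free; the compression is Bałaban's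
`Ω₀Δ′_aΩ₀` (zero outside, boundary = first exterior layer). [folklore] -/
theorem injected_le_box (hS : IsCoordBox M S) (hN : 1 ≤ N) {a' : ℝ} (ha' : 0 < a') :
    ‖(DOm (R * N) M a' (refineR N R M (blockReg N M S)))⁻¹ * JOm N R M (blockReg N M S)
        - JOm N R M (blockReg N M S) * (DOm N M a' (blockReg N M S))⁻¹‖ ≤ Cbox d R a' / N := by
  have hNpos : (0 : ℝ) < N := by exact_mod_cast Nat.pos_of_ne_zero (NeZero.ne N)
  have hC : 0 ≤ Cbox d R a' / N := div_nonneg (mul_nonneg (cDir_nonneg R) (Lam_nonneg (d := d) a')) hNpos.le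
  refine opNorm_le_of_pairing _ hC fun w f => ?_
  rw [form_defect N R M a' (blockReg N M S) ha' w f]
  set u := solExt N M a' (blockReg N M S) f with hu
  set v := solExt (R * N) M a' (refineR N R M (blockReg N M S)) w with hv
  have hΩ' : ∀ x, refineR N R M (blockReg N M S) x ↔ blockReg (R * N) M S x := refineR_blockReg_iff N R M S
  have hu0 : ∀ y, ¬ blockReg N M S y → u y = 0 := fun y hy => solExt_apply_of_not N M a' _ f hy
  have hv0 : ∀ x, ¬ blockReg (R * N) M S x → v x = 0 := fun x hx => solExt_apply_of_not (R * N) M a' _ w (fun h => hx ((hΩ' x).mp h))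
  refine (pairing_le N R M S hN hu0 hv0).trans ?_
  -- the budgets: `Σ budget(u) ≤ Λ nsq f`, `Σ budget′(v) ≤ Λ nsq w` (the fine region in either spelling)
  have hbu : ∑ μ, budget M S N μ u ≤ Lam d a' * nsq f := sum_budget_solExt_le M S hS N ha' _ (fun _ => Iff.rfl) f
  have hbv : ∑ μ, budget M S (R * N) μ v ≤ Lam d a' * nsq w := sum_budget_solExt_le M S hS (R * N) ha' _ hΩ' w
  have hΛ := Lam_nonneg (d := d) a'
  calc cDir R / N * (Real.sqrt (∑ μ, budget M S N μ u) * Real.sqrt (∑ μ, budget M S (R * N) μ v))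
      ≤ cDir R / N * (Real.sqrt (Lam d a' * nsq f) * Real.sqrt (Lam d a' * nsq w)) := by
        refine mul_le_mul_of_nonneg_left (mul_le_mul (Real.sqrt_le_sqrt hbu) (Real.sqrt_le_sqrt hbv) (Real.sqrt_nonneg _)
          (Real.sqrt_nonneg _)) (div_nonneg (cDir_nonneg R) hNpos.le)
    _ = Cbox d R a' / N * Real.sqrt (nsq w) * Real.sqrt (nsq f) := by
        rw [Real.sqrt_mul hΛ, Real.sqrt_mul hΛ, Cbox]
        have e : Real.sqrt (Lam d a') * Real.sqrt (Lam d a') = Lam d a' := Real.mul_self_sqrt hΛ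
        calc cDir R / ↑N * (Real.sqrt (Lam d a') * Real.sqrt (nsq f) * (Real.sqrt (Lam d a') * Real.sqrt (nsq w)))
            = cDir R / ↑N * (Real.sqrt (Lam d a') * Real.sqrt (Lam d a')) * Real.sqrt (nsq w) * Real.sqrt (nsq f) := by ring
          _ = _ := by rw [e]; ring

end Summit.QuantumFields.BalabanUV.Beta.GAN24.DirichletBoxTwoLevel

end
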